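import Literature.AlgebraicGeometry.Morphisms.SmoothOfFlatFibre
import Literature.AlgebraicGeometry.Resolution.AlterationsLemma411
import Mathlib.AlgebraicGeometry.Morphisms.Flat
import HarnessLib

/-!
# One smooth fibre of a flat, universally closed morphism: smoothness over an open set of the
# base, openness of the smooth-fibre locus, smoothness of the generic fibre

Topic: `Literature/AlgebraicGeometry/Morphisms`. Let `f : X → Y` be locally of finite
presentation and universally closed (e.g. proper), flat at the points of the fibre over `y ∈ Y`
(e.g. flat), and assume the fibre `X_y → Spec κ(y)` is smooth. Then:

* `exists_smooth_morphismRestrict_of_smooth_fiber` — `f` is smooth over an open neighbourhood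
  `V` of `y` (EGA IV₄ 17.5.1 pointwise: flat + smooth fibre ⇒ every point over `y` is in the open
  smooth locus `sm(X/Y)`; `f` closed ⇒ `V = Y ∖ f(X ∖ sm(X/Y))` works). This merely chains the
  tree lemmas `mem_smoothLocus_of_flat_stalkMap_of_smooth_fiber` and
  `exists_smooth_morphismRestrict_of_forall_mem_smoothLocus` (`SmoothOfFlatFibre.lean`).
* `exists_forall_smooth_fiber_of_smooth_fiber` — hence ALL fibres over `V` are smooth
  (`Literature.AlgebraicGeometry.Resolution.smooth_fiberToSpecResidueField_of_mem`: a fibre over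
  a point of `V` is a base change of `f⁻¹(V) → V`).
* `isOpen_setOf_smooth_fiber` — for `f` flat, locally of finite presentation and universally
  closed, **the set of `y ∈ Y` with smooth fibre `X_y` is open** (EGA IV₃ 12.2.4 (iii), the
  "lisse" entry, in its elementary form).
* `smooth_fiber_genericPoint_of_smooth_fiber` — for `Y` irreducible: **one smooth fibre forces
  the generic fibre to be smooth** (the generic point lies in every non-empty open set). With
  `[Flat f]`: `smooth_fiber_genericPoint_of_smooth_fiber'`.

The last statement is the form used for one-parameter families `W → U` over a smooth curve
`U` over a perfect field: smoothness of the generic fibre `W_η / K(U)` — which is NOT implied by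
its regularity when `K(U)` is imperfect — follows from the smoothness of a single closed fibre.

What is deliberately NOT here: the converse direction (a smooth generic fibre gives smooth
fibres over a non-empty open set) is `GenericFibreSmooth.lean`; the other entries of
EGA IV₃ 12.2.4 (geometrically regular / normal / reduced fibres) are not treated.

## References

* A. Grothendieck, EGA IV₃ (1966), Thm. 12.2.4 (iii); EGA IV₄ (1967), Thm. 17.5.1.
* The Stacks Project, Tags 01V8, 01VA (smoothness and flatness with smooth fibres), 02GF.
-/

noncomputable section

universe u

open CategoryTheory CategoryTheory.Limits AlgebraicGeometry TopologicalSpace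

namespace Literature.AlgebraicGeometry.Morphisms

variable {X Y : Scheme.{u}}

/-- **Smooth over an open neighbourhood of one smooth fibre.** Let `f : X → Y` be locally of
finite presentation and universally closed, `y ∈ Y`, such that `𝒪_{Y,y} → 𝒪_{X,x}` is flat for
every `x` over `y` and the fibre `X_y → Spec κ(y)` is smooth. Then there is an open `V ∋ y` with
`f⁻¹(V) → V` smooth (EGA IV₄ 17.5.1: every point over `y` lies in the open smooth locus; `f` is
closed, so `Y ∖ f(X ∖ sm(X/Y))` is such a `V`). [cite: EGAIV4, Thm. 17.5.1] -/
theorem exists_smooth_morphismRestrict_of_smooth_fiber (f : X ⟶ Y)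
    [LocallyOfFinitePresentation f] [UniversallyClosed f] {y : Y}
    (hflat : ∀ x : X, f x = y → (f.stalkMap x).hom.Flat)
    (hsm : Smooth (f.fiberToSpecResidueField y)) :
    ∃ V : Y.Opens, y ∈ V ∧ Smooth (f ∣_ V) := by
  refine exists_smooth_morphismRestrict_of_forall_mem_smoothLocus f ?_
  rintro x rfl
  exact mem_smoothLocus_of_flat_stalkMap_of_smooth_fiber f (hflat x rfl) hsm

/-- **All fibres near one smooth fibre are smooth.** Under the hypotheses of
`exists_smooth_morphismRestrict_of_smooth_fiber` (locally of finite presentation, universally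
closed, flat at the points over `y`, `X_y` smooth) there is an open `V ∋ y` such that the fibre
`X_{y'} → Spec κ(y')` is smooth for every `y' ∈ V` (each is a base change of the smooth
`f⁻¹(V) → V`). [cite: EGAIV3, Thm. 12.2.4 (iii)] -/
theorem exists_forall_smooth_fiber_of_smooth_fiber (f : X ⟶ Y)
    [LocallyOfFinitePresentation f] [UniversallyClosed f] {y : Y}
    (hflat : ∀ x : X, f x = y → (f.stalkMap x).hom.Flat)
    (hsm : Smooth (f.fiberToSpecResidueField y)) :
    ∃ V : Y.Opens, y ∈ V ∧ ∀ y' ∈ V, Smooth (f.fiberToSpecResidueField y') := by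
  obtain ⟨V, hyV, hV⟩ := exists_smooth_morphismRestrict_of_smooth_fiber f hflat hsm
  exact ⟨V, hyV, fun y' hy' =>
    Literature.AlgebraicGeometry.Resolution.smooth_fiberToSpecResidueField_of_mem f V hy'⟩

/-- **EGA IV₃ 12.2.4 (iii) for "smooth", elementary form: the smooth-fibre locus of a flat,
universally closed morphism locally of finite presentation is open.** For such `f : X → Y`, the
set of `y ∈ Y` whose fibre `X_y → Spec κ(y)` is smooth is open in `Y`.
[cite: EGAIV3, Thm. 12.2.4 (iii)] -/
theorem isOpen_setOf_smooth_fiber (f : X ⟶ Y) [LocallyOfFinitePresentation f]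
    [UniversallyClosed f] [Flat f] :
    IsOpen {y : Y | Smooth (f.fiberToSpecResidueField y)} := by
  rw [isOpen_iff_forall_mem_open]
  intro y hy
  obtain ⟨V, hyV, hV⟩ :=
    exists_forall_smooth_fiber_of_smooth_fiber f (fun x _ => Flat.stalkMap f x) hy
  exact ⟨V, fun y' hy' => hV y' hy', V.2, hyV⟩

/-- **One smooth fibre forces a smooth generic fibre.** Let `Y` be irreducible with generic
point `η`, `f : X → Y` locally of finite presentation and universally closed, flat at the points
over `y ∈ Y`, with `X_y → Spec κ(y)` smooth. Then the generic fibre `X_η → Spec κ(η)` is smooth: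
`η` lies in the open `V ∋ y` over which `f` is smooth. (For a proper flat family over a smooth
curve over a perfect field this upgrades the — automatic — regularity of a regular total
space's generic fibre to smoothness over the imperfect function field, from ONE closed fibre.)
[cite: EGAIV3, Thm. 12.2.4 (iii)] -/
theorem smooth_fiber_genericPoint_of_smooth_fiber [IrreducibleSpace Y] (f : X ⟶ Y)
    [LocallyOfFinitePresentation f] [UniversallyClosed f] {y : Y}
    (hflat : ∀ x : X, f x = y → (f.stalkMap x).hom.Flat)
    (hsm : Smooth (f.fiberToSpecResidueField y)) :
    Smooth (f.fiberToSpecResidueField (genericPoint Y)) := by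
  obtain ⟨V, hyV, hV⟩ := exists_forall_smooth_fiber_of_smooth_fiber f hflat hsm
  exact hV _ ((genericPoint_specializes y).mem_open V.2 hyV)

/-- **One smooth fibre of a flat, universally closed morphism forces a smooth generic fibre**
(`smooth_fiber_genericPoint_of_smooth_fiber` with `[Flat f]`). [cite: EGAIV3, Thm. 12.2.4 (iii)] -/
theorem smooth_fiber_genericPoint_of_smooth_fiber' [IrreducibleSpace Y] (f : X ⟶ Y)
    [LocallyOfFinitePresentation f] [UniversallyClosed f] [Flat f] {y : Y}
    (hsm : Smooth (f.fiberToSpecResidueField y)) :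
    Smooth (f.fiberToSpecResidueField (genericPoint Y)) :=
  smooth_fiber_genericPoint_of_smooth_fiber f (fun x _ => Flat.stalkMap f x) hsm

end Literature.AlgebraicGeometry.Morphisms

end
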